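import Summits.FinalStateConjecture.FinalStateConjecture.Theorems.EIHFluxBalanceInertialRecessionRechartWhiteHoleMargin
import Summits.FinalStateConjecture.FinalStateConjecture.Theorems.EIHFluxBalanceInertialRecessionRechartWhiteHoleKinematics
import Summits.FinalStateConjecture.FinalStateConjecture.Theorems.EIHFluxBalanceInertialRecessionRechartKO
import Summits.FinalStateConjecture.FinalStateConjecture.Theorems.EIHFluxBalanceInertialRecessionRechartOfut

/-!
# Route EIHFluxBalance — `InertialRecession`, re-charting: the ESCAPE CURVE out of a painted
# white hole

Helper file for the crux `stmt-FinalStateConjecture-10166`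
(`Summit.FinalStateConjecture.FinalStateConjecture.Theses.EIHFluxBalance.InertialRecession`),
stub `stub_rechart` of line `sublinear-is-free-clean-window-charges`.

`exists_escape_curve`: for a hole painted with an ANTI-ORTHOCHRONOUS frame (converging lab velocity,
`ξ̇ᵢ → V`, receding other centres, `C⁰` deviation `→ 0`, (Ofut)), at every late time the chart image of
`σ ↦ x_c + (16θ/π · arctan σ) W₀`, `W₀ = Λ_V(1, ½n̂)` (radially outgoing at half light speed in the frame
of the time-reversed boosted hole — a painted WHITE hole) is a future causal curve of late guaranteed
lab points from painted radius `< 2Mᵢ` to `> 2Mᵢ` (model value `≤ −3/4 + 1/3 +` margins `< −1/5`).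
[folklore; Kerr–Schild 1965; O'Neill 1983, Ch. 14]
-/

noncomputable section

set_option linter.dupNamespace false

open scoped InnerProductSpace Topology Manifold ContDiff BigOperators
open Set Function Filter Metric TopologicalSpace Literature.Geometry.Lorentzian

namespace Summit.FinalStateConjecture.FinalStateConjecture.Theorems

/-! ### The escape curve -/

/-- The size parameter `θ = min(M/10, (2M − rin)/6)` of the escape segment is positive (registered
helper stub `escape_theta_pos_rechart` of the crux item). [folklore] -/
theorem escape_theta_pos_rechart : ∀ {M r : ℝ}, 0 < M → r < 2 * M → 0 < min (M / 10) ((2 * M - r) / 6) :=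
  fun hM hr ↦ lt_min (by positivity) (by linarith)


section Escape

variable {𝓢 : Spacetime 4} {N : ℕ}

-- long bookkeeping proof
set_option maxHeartbeats 1600000 in
/-- **The escape curve out of a painted white hole.** See the module docstring. [folklore] -/
theorem exists_escape_curve (i : Fin N) (M rin K : Fin N → ℝ) (Λ : Fin N → ℝ → lorentzGroup)
    (ξ : Fin N → ℝ → E3) (hM : 0 < M i) (hrin : rin i < 2 * M i) {γ : ℝ}
    (hγb : ∀ j t, |((Λ j t : E4 ≃L[ℝ] E4) (E4.basisVector 0)) 0| ≤ γ)
    (hΛc : ∀ j, Continuous fun t ↦ ((Λ j t : E4 ≃L[ℝ] E4) : E4 →L[ℝ] E4))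
    (hξc : ∀ j, Continuous (ξ j)) (hξd : Differentiable ℝ (ξ i)) {V : E3} (hV : ‖V‖ < 1)
    (hξV : Tendsto (deriv (ξ i)) atTop (𝓝 V))
    (hneg : ∀ t, ((Λ i t : E4 ≃L[ℝ] E4) (E4.basisVector 0)) 0 < 0)
    (hv : Tendsto (fun t ↦ (((Λ i t : E4 ≃L[ℝ] E4) (E4.basisVector 0)) 0)⁻¹ •
      E4.spatial ((Λ i t : E4 ≃L[ℝ] E4) (E4.basisVector 0))) atTop (𝓝 V))
    (hsep : ∀ j, j ≠ i → Tendsto (fun t ↦ ‖ξ i t - ξ j t‖) atTop atTop)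
    (U : Opens E4) (Φ : U → 𝓢.carrier) (hΦ : ContMDiff 𝓘(ℝ, E4) (𝓡 4) ∞ Φ) {τ₀ : ℝ}
    (hU : {x : E4 | τ₀ < x 0 ∧ ∀ j, rin j < Kerr.radius 0 (poincareInv (Λ j (x 0))
      (E4.ofTimeSpace (x 0) (ξ j (x 0))) x)} ⊆ (U : Set E4))
    {k : ℕ} (hdev : Tendsto (fun t ↦ 𝓢.deviationCk ⟨U, fun x ↦ Minkowski.bilin +
      ∑ j, (boostedKerrBilin (Λ j (x 0)) (E4.ofTimeSpace (x 0) (ξ j (x 0))) (M j) 0 x -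
        Minkowski.bilin), fun x ↦ x 0, E4.spatialNorm⟩ Φ k t) atTop (𝓝 0))
    {TO : ℝ}
    (hOfut : ∀ x : U, TO < x.1 0 → (∀ j, rin j < Kerr.radius 0 (poincareInv (Λ j (x.1 0))
      (E4.ofTimeSpace (x.1 0) (ξ j (x.1 0))) x.1)) → ∀ w : E4, 0 < w 0 →
      𝓢.metric.val (Φ x) (mfderiv 𝓘(ℝ, E4) (𝓡 4) Φ x w) (mfderiv 𝓘(ℝ, E4) (𝓡 4) Φ x w) < 0 →
        𝓢.timeOrientation.IsFutureDirected (mfderiv 𝓘(ℝ, E4) (𝓡 4) Φ x w))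
    (Tlate : ℝ) :
    ∃ (xs : ℝ → E4) (hxsU : ∀ σ, xs σ ∈ (U : Set E4)),
      𝓢.metric.IsFutureCausalCurveOn 𝓢.timeOrientation (fun σ ↦ Φ ⟨xs σ, hxsU σ⟩) (Icc 0 1) ∧
      (∀ σ, Tlate < xs σ 0 ∧
        (∀ j, rin j < Kerr.radius 0 (poincareInv (Λ j (xs σ 0))
          (E4.ofTimeSpace (xs σ 0) (ξ j (xs σ 0))) (xs σ))) ∧
        ∀ j, j ≠ i → K j < Kerr.radius 0 (poincareInv (Λ j (xs σ 0))
          (E4.ofTimeSpace (xs σ 0) (ξ j (xs σ 0))) (xs σ))) ∧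
      Kerr.radius 0 (poincareInv (Λ i (xs 0 0)) (E4.ofTimeSpace (xs 0 0) (ξ i (xs 0 0))) (xs 0)) <
        2 * M i ∧
      2 * M i < Kerr.radius 0 (poincareInv (Λ i (xs 1 0))
        (E4.ofTimeSpace (xs 1 0) (ξ i (xs 1 0))) (xs 1)) := by
  -- ### the lab background
  set B : ModelBackground := ⟨U, fun x ↦ Minkowski.bilin +
      ∑ j, (boostedKerrBilin (Λ j (x 0)) (E4.ofTimeSpace (x 0) (ξ j (x 0))) (M j) 0 x -
        Minkowski.bilin), fun x ↦ x 0, E4.spatialNorm⟩ with hB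
  -- ### constants
  set Mi : ℝ := M i with hMi
  set θ : ℝ := min (Mi / 10) ((2 * Mi - rin i) / 6) with hθ
  have hθ0 : 0 < θ := escape_theta_pos_rechart hM hrin
  have hθM : θ ≤ Mi / 10 := min_le_left _ _
  have hθr : θ ≤ (2 * Mi - rin i) / 6 := min_le_right _ _
  set r₀ : ℝ := 2 * Mi - 5 * θ with hr₀
  have hr₀M : 3 * Mi / 2 ≤ r₀ := by rw [hr₀]; linarith
  have hr₀0 : 0 < r₀ := by linarith
  set n : E3 := EuclideanSpace.single 0 1 with hn
  have hn1 : ‖n‖ = 1 := by rw [hn, PiLp.norm_single, norm_one]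
  set W₀ : E4 := Lorentz.boostCLM V (E4.ofTimeSpace 1 ((1 / 2 : ℝ) • n)) with hW₀
  have hγV := Lorentz.gamma_pos hV
  have hW0pos : 0 < W₀ 0 := boostCLM_escape_apply_zero_pos hV hn1
  set c₁ : ℝ := 16 * θ / Real.pi with hc₁
  have hc₁0 : 0 < c₁ := by rw [hc₁]; positivity
  set ε : ℝ := min (1 / 10) (θ / 2) with hε
  have hε0 : 0 < ε := lt_min (by norm_num) (by linarith)
  have hε10 : ε ≤ 1 / 10 := min_le_left _ _
  have hεθ : ε ≤ θ / 2 := min_le_right _ _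
  -- the frozen rest-time function and the margin
  set b₀ : E4 := Lorentz.boostCLM V (E4.ofTimeSpace 0 ((2 * Mi - θ) • n)) with hb₀
  set ζ : ℝ → ℝ := fun s' ↦ (s' - 8 * θ) - (b₀ 0 + (s' - 8 * θ) * W₀ 0) * (Lorentz.gamma V)⁻¹
    with hζ
  have hζc : Continuous ζ := by rw [hζ]; fun_prop
  obtain ⟨δ, hδ, hmarg⟩ := exists_escape_margin hV hn1 (16 * θ) (le_of_lt (by rwa [hMi] at hM : 0 < Mi)) hr₀0 ζ hζc W₀ hW₀
    (fun p ↦ Real.sqrt (Minkowski.bilin p.1 p.2 ^ 2 + Minkowski.bilin p.1 p.1))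
    (fun p ↦ Minkowski.bilin W₀ W₀ + 2 * (Mi / Real.sqrt (Minkowski.bilin p.1 p.2 ^ 2 +
      Minkowski.bilin p.1 p.1)) * (-Minkowski.bilin W₀ p.2 + (Minkowski.bilin p.1 W₀ +
        Minkowski.bilin p.1 p.2 * Minkowski.bilin W₀ p.2) /
          Real.sqrt (Minkowski.bilin p.1 p.2 ^ 2 + Minkowski.bilin p.1 p.1)) ^ 2)
    (fun _ ↦ rfl) (fun _ ↦ rfl) hε0
  have hbasec := continuous_frozenRay V n r₀ hζc
  obtain ⟨Zb, hZb⟩ := isCompact_Icc.exists_bound_of_continuousOn (hbasec.continuousOn (s := Icc 0 (16 * θ)))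
  have hZb0 : 0 ≤ Zb := (norm_nonneg _).trans (hZb 0 ⟨le_rfl, by linarith⟩)
  set Lw : ℝ := |b₀ 0| + 8 * θ * W₀ 0 + 1 with hLw
  have hLw0 : 0 < Lw := by rw [hLw]; positivity
  obtain ⟨Td, hTd⟩ := exists_drift_le hξd hξV hLw0 hδ
  obtain ⟨Tu, hTu⟩ : ∃ Tu : ℝ, ∀ t, Tu ≤ t →
      ‖((Λ i t : E4 ≃L[ℝ] E4) (E4.basisVector 0) : E4) - -Lorentz.boostCLM V (E4.basisVector 0)‖ ≤ δ := by
    obtain ⟨Tu, hTu⟩ := (Metric.tendsto_atTop.mp (tendsto_fourVelocity_of_neg (Λ i) hneg hV hv)) δ hδ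
    exact ⟨Tu, fun t ht ↦ by rw [← dist_eq_norm]; exact (hTu t ht).le⟩
  have hγ0 : 0 ≤ γ := (abs_nonneg _).trans (hγb i 0)
  obtain ⟨C, hC0, hfar⟩ := exists_farField_bound (Γ := 1 + 3 * γ) (by linarith)
  have hΛinv : ∀ j, Continuous fun t : ℝ ↦ (((Λ j t : E4 ≃L[ℝ] E4).symm : E4 ≃L[ℝ] E4) : E4 →L[ℝ] E4) :=
    fun j ↦ continuous_lorentz_symm_of_continuous (hΛc j)
  have hΛb : ∀ j t, ‖(((Λ j t : E4 ≃L[ℝ] E4).symm : E4 ≃L[ℝ] E4) : E4 →L[ℝ] E4)‖ ≤ 1 + 3 * γ :=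
    fun j t ↦ (norm_lorentz_symm_le' (Λ j t)).trans (by linarith [hγb j t])
  set Dfar : ℝ := 1 + 10 * (N + 1) * C * ‖W₀‖ ^ 2 * (∑ j, |M j| + 1) with hDfar
  have hDfar1 : 1 ≤ Dfar := by
    rw [hDfar]
    have : 0 ≤ ∑ j, |M j| := Finset.sum_nonneg fun j _ ↦ abs_nonneg _
    have : 0 ≤ 10 * ((N : ℝ) + 1) * C * ‖W₀‖ ^ 2 * (∑ j, |M j| + 1) := by positivity
    linarith
  have hDfarM : ∀ j, 10 * (N + 1) * (|M j| * C * ‖W₀‖ ^ 2) ≤ Dfar := by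
    intro j
    rw [hDfar]
    have h1 : |M j| ≤ ∑ j, |M j| + 1 := by
      have := Finset.single_le_sum (f := fun j ↦ |M j|) (fun j _ ↦ abs_nonneg _) (Finset.mem_univ j)
      linarith
    have h2 : 0 ≤ 10 * ((N : ℝ) + 1) * C * ‖W₀‖ ^ 2 := by positivity
    nlinarith
  have hsep' : ∀ j, ∃ Ts : ℝ, j ≠ i → ∀ t, Ts ≤ t → Dfar + Zb + δ + |K j| + |rin j| + 1 ≤ ‖ξ i t - ξ j t‖ := by
    intro j
    by_cases hj : j = i
    · exact ⟨0, fun h ↦ (h hj).elim⟩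
    · obtain ⟨Ts, hTs⟩ := eventually_atTop.1 (tendsto_atTop.1 (hsep j hj) (Dfar + Zb + δ + |K j| + |rin j| + 1))
      exact ⟨Ts, fun _ t ht ↦ hTs t ht⟩
  choose Ts hTs using hsep'
  set cdev : ℝ := 1 / (10 * (‖W₀‖ ^ 2 + 1)) with hcdev
  have hcdev0 : 0 < cdev := by rw [hcdev]; positivity
  obtain ⟨Tdv, hTdv⟩ := (ENNReal.tendsto_atTop_zero.mp hdev) (ENNReal.ofReal cdev)
    (ENNReal.ofReal_pos.mpr hcdev0)
  set t₀ : ℝ := |Tlate| + |τ₀| + |TO| + |Td| + |Tu| + |Tdv| + ∑ j, |Ts j| + 2 * Lw + 1 with ht₀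
  have hTsj : ∀ j, Ts j ≤ ∑ j, |Ts j| := fun j ↦ (le_abs_self _).trans
    (Finset.single_le_sum (f := fun j ↦ |Ts j|) (fun j _ ↦ abs_nonneg _) (Finset.mem_univ j))
  have ht₀ge : ∀ T : ℝ, t₀ - Lw ≤ T → Tlate < T ∧ τ₀ < T ∧ TO < T ∧ Td + Lw ≤ t₀ ∧ Tu ≤ T ∧
      Tdv ≤ T ∧ ∀ j, Ts j ≤ T := by
    intro T hT
    have h0 : 0 ≤ ∑ j, |Ts j| := Finset.sum_nonneg fun j _ ↦ abs_nonneg _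
    have := le_abs_self Tlate; have := le_abs_self τ₀; have := le_abs_self TO
    have := le_abs_self Td; have := le_abs_self Tu; have := le_abs_self Tdv
    have := abs_nonneg Tlate; have := abs_nonneg τ₀; have := abs_nonneg TO
    have := abs_nonneg Td; have := abs_nonneg Tu; have := abs_nonneg Tdv
    refine ⟨by linarith, by linarith, by linarith, by linarith, by linarith, by linarith,
      fun j ↦ (hTsj j).trans (by linarith)⟩
  set xc : E4 := E4.ofTimeSpace t₀ (ξ i t₀) + b₀ with hxc
  set xs : ℝ → E4 := fun σ ↦ xc + (c₁ * Real.arctan σ) • W₀ with hxs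
  -- the radius parameter `s' = c₁ arctan σ + 8θ ∈ (0, 16θ)`
  have hs'mem : ∀ σ, c₁ * Real.arctan σ + 8 * θ ∈ Icc 0 (16 * θ) ∧ |c₁ * Real.arctan σ| ≤ 8 * θ :=
    fun σ ↦ arctan_scale_bounds hθ0 σ
  have hT : ∀ σ, xs σ 0 = t₀ + b₀ 0 + (c₁ * Real.arctan σ) * W₀ 0 := by
    intro σ
    simp only [hxs, hxc, PiLp.add_apply, PiLp.smul_apply, smul_eq_mul, E4.ofTimeSpace_apply_zero]
  have hTwin : ∀ σ, |xs σ 0 - t₀| ≤ Lw := by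
    intro σ
    rw [hT σ, show t₀ + b₀ 0 + c₁ * Real.arctan σ * W₀ 0 - t₀ = b₀ 0 + c₁ * Real.arctan σ * W₀ 0 by ring]
    have h1 : |c₁ * Real.arctan σ * W₀ 0| ≤ 8 * θ * W₀ 0 := by
      rw [abs_mul, abs_of_pos hW0pos]
      exact mul_le_mul_of_nonneg_right (hs'mem σ).2 hW0pos.le
    calc |b₀ 0 + c₁ * Real.arctan σ * W₀ 0| ≤ |b₀ 0| + |c₁ * Real.arctan σ * W₀ 0| := abs_add_le _ _
      _ ≤ Lw := by rw [hLw]; linarith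
  have hlate : ∀ σ, t₀ - Lw ≤ xs σ 0 := fun σ ↦ by
    have := (abs_le.mp (hTwin σ)).1; linarith
  -- the frozen decomposition `xs σ − c̃(T) = Λ_V (ζ s', (r₀ + s'/2) n̂)`
  have hfrozen : ∀ σ, xs σ - E4.ofTimeSpace (xs σ 0) (ξ i t₀ + (xs σ 0 - t₀) • V) =
      Lorentz.boostCLM V (E4.ofTimeSpace (ζ (c₁ * Real.arctan σ + 8 * θ))
        ((r₀ + (c₁ * Real.arctan σ + 8 * θ) / 2) • n)) := by
    intro σ
    set s : ℝ := c₁ * Real.arctan σ with hs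
    have hTs : xs σ 0 - t₀ = b₀ 0 + s * W₀ 0 := by rw [hT σ]; ring
    have hc : E4.ofTimeSpace (xs σ 0) (ξ i t₀ + (xs σ 0 - t₀) • V) =
        E4.ofTimeSpace t₀ (ξ i t₀) + (xs σ 0 - t₀) • E4.ofTimeSpace 1 V := by
      rw [ofTimeSpace_add_smul]; congr 1; ring
    rw [hc, hTs]
    simp only [hxs, hxc, hb₀, hW₀, ← hs]
    rw [show ∀ (a b c d : E4), a + b + c - (a + d) = b + c - d from fun a b c d ↦ by abel,
      frozen_decomposition hV n (2 * Mi - θ) s (b₀ 0 + s * W₀ 0)]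
    simp only [hζ, hb₀, hW₀]
    congr 2
    · ring
    · rw [hr₀]; congr 1; ring
  have hrin6 : rin i ≤ 2 * Mi - 6 * θ := by linarith
  have hMr : Mi / (2 * r₀) ≤ 1 / 3 := by
    rw [div_le_div_iff₀ (by linarith) (by norm_num : (0:ℝ) < 3)]
    have : 0 < Mi := by rwa [hMi]
    nlinarith
  have hmain : ∀ σ,
      |Kerr.radius 0 (poincareInv (Λ i (xs σ 0)) (E4.ofTimeSpace (xs σ 0) (ξ i (xs σ 0))) (xs σ)) -
          (r₀ + (c₁ * Real.arctan σ + 8 * θ) / 2)| < ε ∧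
        boostedKerrBilin (Λ i (xs σ 0)) (E4.ofTimeSpace (xs σ 0) (ξ i (xs σ 0))) Mi 0 (xs σ) W₀ W₀ <
          -(3 / 4) + Mi / (2 * r₀) + ε ∧
        ‖E4.spatial (xs σ) - ξ i (xs σ 0)‖ ≤ Zb + δ := by
    intro σ
    set x : E4 := xs σ with hx
    set T : ℝ := x 0 with hTdef
    obtain ⟨-, -, -, hTdL, hTuT, -, -⟩ := ht₀ge T (hlate σ)
    set s' : ℝ := c₁ * Real.arctan σ + 8 * θ with hs'
    have hs'I : s' ∈ Icc 0 (16 * θ) := (hs'mem σ).1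
    set z : E4 := x - E4.ofTimeSpace T (ξ i T) with hz
    set u : E4 := ((Λ i T : E4 ≃L[ℝ] E4) (E4.basisVector 0) : E4) with hu
    set zf : E4 := Lorentz.boostCLM V (E4.ofTimeSpace (ζ s') ((r₀ + s' / 2) • n)) with hzf
    have hzf' : x - E4.ofTimeSpace T (ξ i t₀ + (T - t₀) • V) = zf := hfrozen σ
    have hzd : ‖z - zf‖ ≤ δ := by
      have he : z - zf = E4.ofTimeSpace 0 (ξ i t₀ + (T - t₀) • V - ξ i T) := by
        rw [← hzf', hz, show ∀ (a b c : E4), a - b - (a - c) = c - b from fun a b c ↦ by abel,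
          ← one_smul ℝ (E4.ofTimeSpace T (ξ i T)), ofTimeSpace_sub_smul, one_mul, sub_self, one_smul]
      rw [he, norm_eq_spatialNorm_of_apply_zero_eq_zero (E4.ofTimeSpace_apply_zero 0 _),
        E4.spatialNorm_ofTimeSpace, show ξ i t₀ + (T - t₀) • V - ξ i T =
        -(ξ i T - ξ i t₀ - (T - t₀) • V) by abel, norm_neg]
      exact hTd t₀ T hTdL (hTwin σ)
    have hud : ‖u - -Lorentz.boostCLM V (E4.basisVector 0)‖ ≤ δ := hTu T hTuT
    obtain ⟨hR, hTv⟩ := hmarg s' hs'I z u hzd hud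
    -- the painted radius
    have hrad : Kerr.radius 0 (poincareInv (Λ i T) (E4.ofTimeSpace T (ξ i T)) x) =
        Real.sqrt (Minkowski.bilin z u ^ 2 + Minkowski.bilin z z) := radius_poincareInv_zero_eq_sqrt _ _ _
    have hR' : |Kerr.radius 0 (poincareInv (Λ i T) (E4.ofTimeSpace T (ξ i T)) x) - (r₀ + s' / 2)| < ε := by
      rw [hrad]; exact hR
    have hr0 : Kerr.radius 0 (poincareInv (Λ i T) (E4.ofTimeSpace T (ξ i T)) x) ≠ 0 := by
      have := (abs_lt.mp hR').1
      have : 0 ≤ s' := hs'I.1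
      linarith
    -- the painted value
    have hval : boostedKerrBilin (Λ i T) (E4.ofTimeSpace T (ξ i T)) Mi 0 x W₀ W₀ <
        -(3 / 4) + Mi / (2 * r₀) + ε := by
      rw [boostedKerrBilin_zero_spin_apply_self _ _ _ _ _ hr0, hrad]
      exact hTv
    -- the lab distance to the centre
    have hdist : ‖E4.spatial x - ξ i T‖ ≤ Zb + δ := by
      obtain ⟨-, hn'⟩ := sub_ofTimeSpace_apply_zero (rfl : x 0 = T) (ξ i T)
      rw [← hn']
      have h1 : ‖z‖ ≤ ‖zf‖ + ‖z - zf‖ := norm_le_norm_add_norm_sub' z zf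
      have h2 : ‖zf‖ ≤ Zb := hZb s' hs'I
      show ‖z‖ ≤ Zb + δ
      linarith
    exact ⟨hR', hval, hdist⟩
  -- radii: hole `i` and the other holes
  have hri : ∀ σ, rin i < Kerr.radius 0 (poincareInv (Λ i (xs σ 0))
      (E4.ofTimeSpace (xs σ 0) (ξ i (xs σ 0))) (xs σ)) := by
    intro σ
    obtain ⟨hR, -, -⟩ := hmain σ
    have := (abs_lt.mp hR).1
    have : 0 ≤ c₁ * Real.arctan σ + 8 * θ := (hs'mem σ).1.1
    linarith
  have hrj : ∀ σ j, j ≠ i → Dfar ≤ ‖E4.spatial (xs σ) - ξ j (xs σ 0)‖ ∧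
      K j < Kerr.radius 0 (poincareInv (Λ j (xs σ 0)) (E4.ofTimeSpace (xs σ 0) (ξ j (xs σ 0))) (xs σ)) ∧
      rin j < Kerr.radius 0 (poincareInv (Λ j (xs σ 0)) (E4.ofTimeSpace (xs σ 0) (ξ j (xs σ 0))) (xs σ)) := by
    intro σ j hj
    obtain ⟨-, -, hdist⟩ := hmain σ
    obtain ⟨-, -, -, -, -, -, hTsT⟩ := ht₀ge (xs σ 0) (hlate σ)
    have hsepT := hTs j hj (xs σ 0) (hTsT j)
    have htri : ‖ξ i (xs σ 0) - ξ j (xs σ 0)‖ ≤ ‖E4.spatial (xs σ) - ξ i (xs σ 0)‖ +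
        ‖E4.spatial (xs σ) - ξ j (xs σ 0)‖ := by
      rw [← norm_neg (E4.spatial (xs σ) - ξ i (xs σ 0))]
      have := norm_add_le (-(E4.spatial (xs σ) - ξ i (xs σ 0))) (E4.spatial (xs σ) - ξ j (xs σ 0))
      rwa [show -(E4.spatial (xs σ) - ξ i (xs σ 0)) + (E4.spatial (xs σ) - ξ j (xs σ 0)) =
        ξ i (xs σ 0) - ξ j (xs σ 0) by abel] at this
    have hD : Dfar + |K j| + |rin j| + 1 ≤ ‖E4.spatial (xs σ) - ξ j (xs σ 0)‖ := by linarith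
    have hrad : ‖E4.spatial (xs σ) - ξ j (xs σ 0)‖ ≤ Kerr.radius 0 (poincareInv (Λ j (xs σ 0))
        (E4.ofTimeSpace (xs σ 0) (ξ j (xs σ 0))) (xs σ)) :=
      norm_spatial_sub_le_radius_poincareInv (Λ j (xs σ 0)) (xs σ 0) (ξ j (xs σ 0)) rfl
    refine ⟨by linarith [abs_nonneg (K j), abs_nonneg (rin j)], ?_, ?_⟩
    · linarith [le_abs_self (K j), abs_nonneg (rin j)]
    · linarith [le_abs_self (rin j), abs_nonneg (K j)]
  have hguar : ∀ σ j, rin j < Kerr.radius 0 (poincareInv (Λ j (xs σ 0))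
      (E4.ofTimeSpace (xs σ 0) (ξ j (xs σ 0))) (xs σ)) := by
    intro σ j
    by_cases hj : j = i
    · subst hj; exact hri σ
    · exact (hrj σ j hj).2.2
  have hxsU : ∀ σ, xs σ ∈ (U : Set E4) := fun σ ↦
    hU ⟨(ht₀ge _ (hlate σ)).2.1, hguar σ⟩
  -- the model value at the points of the segment
  have hbil : ∀ σ, B.bilin (xs σ) W₀ W₀ ≤ -(1 / 5) := by
    intro σ
    show (Minkowski.bilin + ∑ j, (boostedKerrBilin (Λ j (xs σ 0))
      (E4.ofTimeSpace (xs σ 0) (ξ j (xs σ 0))) (M j) 0 (xs σ) - Minkowski.bilin)) W₀ W₀ ≤ -(1 / 5)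
    obtain ⟨-, hval, -⟩ := hmain σ
    set f : Fin N → ℝ := fun j ↦ (boostedKerrBilin (Λ j (xs σ 0))
      (E4.ofTimeSpace (xs σ 0) (ξ j (xs σ 0))) (M j) 0 (xs σ) - Minkowski.bilin) W₀ W₀ with hf
    have hexp : (Minkowski.bilin + ∑ j, (boostedKerrBilin (Λ j (xs σ 0))
        (E4.ofTimeSpace (xs σ 0) (ξ j (xs σ 0))) (M j) 0 (xs σ) - Minkowski.bilin)) W₀ W₀ =
        Minkowski.bilin W₀ W₀ + ∑ j, f j := by
      simp only [hf, FunLike.coe_add, FunLike.coe_sum, Pi.add_apply, Finset.sum_apply]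
    have hsplit : ∑ j, f j = f i + ∑ j ∈ Finset.univ.erase i, f j :=
      (Finset.add_sum_erase _ _ (Finset.mem_univ i)).symm
    have hfi : f i = boostedKerrBilin (Λ i (xs σ 0)) (E4.ofTimeSpace (xs σ 0) (ξ i (xs σ 0))) Mi 0
        (xs σ) W₀ W₀ - Minkowski.bilin W₀ W₀ := by
      simp only [hf, FunLike.coe_sub, Pi.sub_apply, hMi]
    -- the other holes contribute little
    have hfar' : ∀ j, j ≠ i → |f j| ≤ 1 / (10 * (N + 1)) := by
      intro j hj
      obtain ⟨hD, -, -⟩ := hrj σ j hj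
      have hD0 : 0 < ‖E4.spatial (xs σ) - ξ j (xs σ 0)‖ := by linarith
      have h1 := hfar (M j) (Λ j) (ξ j) (xs σ 0) (xs σ) (hΛinv j) (hξc j) (hΛb j) rfl (hDfar1.trans hD)
      have h2 : |f j| ≤ ‖boostedKerrBilin (Λ j (xs σ 0)) (E4.ofTimeSpace (xs σ 0) (ξ j (xs σ 0)))
          (M j) 0 (xs σ) - Minkowski.bilin‖ * ‖W₀‖ * ‖W₀‖ := abs_apply_self_le_opNorm _ _
      have h3 : ‖boostedKerrBilin (Λ j (xs σ 0)) (E4.ofTimeSpace (xs σ 0) (ξ j (xs σ 0))) (M j) 0 (xs σ) -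
          Minkowski.bilin‖ * ‖W₀‖ * ‖W₀‖ ≤ |M j| * C / Dfar * ‖W₀‖ * ‖W₀‖ := by
        have : |M j| * C / ‖E4.spatial (xs σ) - ξ j (xs σ 0)‖ ≤ |M j| * C / Dfar :=
          div_le_div_of_nonneg_left (by positivity) (by linarith) hD
        have hW : 0 ≤ ‖W₀‖ := norm_nonneg _
        exact mul_le_mul_of_nonneg_right (mul_le_mul_of_nonneg_right (h1.trans this) hW) hW
      have h4 : |M j| * C / Dfar * ‖W₀‖ * ‖W₀‖ ≤ 1 / (10 * (N + 1)) := by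
        have hDpos : 0 < Dfar := by linarith
        rw [show |M j| * C / Dfar * ‖W₀‖ * ‖W₀‖ = (|M j| * C * ‖W₀‖ ^ 2) / Dfar by ring,
          div_le_div_iff₀ hDpos (by positivity)]
        have := hDfarM j
        nlinarith
      exact h2.trans (h3.trans h4)
    have hsum : ∑ j ∈ Finset.univ.erase i, f j ≤ 1 / 10 := sum_erase_le_tenth i f hfar'
    rw [hexp, hsplit, hfi]
    linarith
  -- the deviation at the points of the segment
  have hdevpt : ∀ σ, ‖𝓢.deviation B Φ ⟨xs σ, hxsU σ⟩‖ ≤ cdev := by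
    intro σ
    obtain ⟨-, -, -, -, -, hTdvT, -⟩ := ht₀ge (xs σ 0) (hlate σ)
    have h1 : 𝓢.deviationCk B Φ k (B.time (xs σ)) ≤ ENNReal.ofReal cdev := hTdv _ hTdvT
    exact norm_deviation_le_of_deviationCk_le 𝓢 B Φ k hcdev0.le ⟨xs σ, hxsU σ⟩ h1
  have hcW : cdev * ‖W₀‖ ^ 2 < 1 / 5 := by
    rw [hcdev, one_div, inv_mul_eq_div, div_lt_div_iff₀ (by positivity) (by norm_num)]
    nlinarith [norm_nonneg W₀]
  -- future-directed push-forwards of `W₀`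
  have hfd : ∀ σ, 𝓢.timeOrientation.IsFutureDirected (mfderiv 𝓘(ℝ, E4) (𝓡 4) Φ ⟨xs σ, hxsU σ⟩ W₀) := by
    intro σ
    obtain ⟨-, -, hTO, -, -, -, -⟩ := ht₀ge (xs σ 0) (hlate σ)
    have h := isFutureDirected_mfderiv_comp_of_deviation B U Φ hΦ (A := id) contDiff_id (fun x hx ↦ hx)
      (fun y : U ↦ TO < y.1 0 ∧ ∀ j, rin j < Kerr.radius 0 (poincareInv (Λ j (y.1 0))
        (E4.ofTimeSpace (y.1 0) (ξ j (y.1 0))) y.1))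
      (fun y hQ w hw hg ↦ hOfut y hQ.1 hQ.2 w hw hg) ⟨xs σ, hxsU σ⟩ W₀ ⟨hTO, hguar σ⟩
      (by rw [fderiv_id]; exact hW0pos) (m := 1 / 5) (c := cdev) (hbil σ) hcW (hdevpt σ)
    exact h
  -- ### the curve
  have hp : ContDiff ℝ ∞ xs := by
    rw [hxs]
    exact contDiff_const.add ((contDiff_const.mul Real.contDiff_arctan).smul contDiff_const)
  have hpd : ∀ σ, HasDerivAt xs ((c₁ / (1 + σ ^ 2)) • W₀) σ := by
    intro σ
    have h1 : HasDerivAt (fun s ↦ c₁ * Real.arctan s) (c₁ * (1 / (1 + σ ^ 2))) σ :=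
      (Real.hasDerivAt_arctan σ).const_mul c₁
    have h2 := (h1.smul_const W₀).const_add xc
    refine h2.congr_deriv ?_
    rw [mul_one_div]
  have hcurve : 𝓢.metric.IsFutureCausalCurveOn 𝓢.timeOrientation (fun σ ↦ Φ ⟨xs σ, hxsU σ⟩)
      (Icc 0 1) := by
    intro σ _
    obtain ⟨hd, hv⟩ := velocity_comp_smooth_curve hΦ hp hxsU (hpd σ)
    refine ⟨hd, ?_⟩
    have hv' : velocity (𝓡 4) (fun s ↦ Φ ⟨xs s, hxsU s⟩) σ =
        (c₁ / (1 + σ ^ 2)) • mfderiv 𝓘(ℝ, E4) (𝓡 4) Φ ⟨xs σ, hxsU σ⟩ W₀ := by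
      rw [hv]
      exact (mfderiv 𝓘(ℝ, E4) (𝓡 4) Φ ⟨xs σ, hxsU σ⟩).map_smul _ _
    rw [hv']
    exact (hfd σ).smul (by positivity)
  -- ### endpoints and conclusion
  refine ⟨xs, hxsU, hcurve, fun σ ↦ ⟨(ht₀ge _ (hlate σ)).1, hguar σ, fun j hj ↦ (hrj σ j hj).2.1⟩,
    ?_, ?_⟩
  · obtain ⟨hR, -, -⟩ := hmain 0
    rw [Real.arctan_zero, mul_zero, zero_add] at hR
    have := (abs_lt.mp hR).2
    rw [hMi] at hr₀
    show _ < 2 * M i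
    linarith
  · obtain ⟨hR, -, -⟩ := hmain 1
    rw [Real.arctan_one] at hR
    have hc : c₁ * (Real.pi / 4) = 4 * θ := by rw [hc₁]; field_simp; ring
    rw [hc] at hR
    have := (abs_lt.mp hR).1
    show 2 * M i < _
    rw [hMi] at hr₀
    linarith

end Escape

end Summit.FinalStateConjecture.FinalStateConjecture.Theorems
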